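/-
Copyright (c) 2026 the pub-hodgecm-mathlib formalisation cell (harness21).  Prover seat hodgecm-mathlib-K2Liu-p05 (g4), 2026-09-04
(Track B «K2-LIT», crux hLiu418 = stmt-HodgeConjecture-24832, socket #42F′, ROAD I v3, organ G2-Weil, bridge (G2-W4) part W4-iii (by-name glue):
the one-place curve `placeSecJ σ (exp (sY), 1)` IS an archimedean one-parameter orbit `archExp hX s`; hence the `hXφ` certificate for Siegel–Weil sections).
-/
import Summits.HodgeConjecture.HodgeConjecture.Theorems.K2LiuSwSectionArchOrbitDeriv       -- ★ p858684 (W4-ii derivative)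
import Summits.HodgeConjecture.HodgeConjecture.Theorems.K2LiuArchSkewPlaces                -- ★ p858452 (K2Liu-p11): `exists_archSkew_single`, `coe_archAt_expGL_smul`, `skew_of_forall_exp_mem`
import Literature.Analysis.Matrix.KroneckerSumExp                                           -- ★ `exp_reindex`
import HarnessLib

/-!
# (G2-W4-iii, glue) `placeSecJ σ (exp (sY), 1) = exp (sX)` for a letter `X ∈ 𝔲` supported at `σ`; the `hXφ` certificate for Siegel–Weil sections

Track B ∕ K2-LIT, hLiu418 = stmt-HodgeConjecture-24832, #42F′ ROAD I v3 organ G2-Weil (LEAD F0P6-plan (g13) 09:00:18Z «(i) the W4-ii BY-NAME glue NOW: curve identity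
`archEmb (placeSecJ σ (expMem (s•Y),1)) = archExp hX s` … makes ★ p858684 the typist's `hXφ` certificate by name»).  Namespaces
`…Cruxes.HLiu418.K2LiuArchSectionPlaceBlock` (§1–§2, generic `(E, c, N, J = diag t₀ ⊗ 1, δ)`) and `…Cruxes.HLiu418.K2LiuSwSectionArchOrbit` (§3, the doubled CM
frame).  THEOREMS ONLY (no definition, no instance, no notation, no named fact, no `sorry`); the Mathlib idiom `attribute [local instance 100] LieRing.ofAssociativeRing`
(to name `(uFormGroup P′ Q′).lie`, as (G2-W2) ∕ ★ p858684); `--supports stmt-HodgeConjecture-24832 --as helper`.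

* §1 THE SIGN-FRAME CHART IN MATRICES: `coe_toUFormEquiv_symm` — the matrix of `(toUFormEquiv ε_σ D_σ c_σ)⁻¹ g′` is `diag(D_σ)⁻¹ · g′^{ε_σ} · diag(D_σ)`
  (★ `coe_toUForm`, ★ `toUForm_toUFormEquiv_symm`, ★ `scaleGL_mul_mul_inv`); `coe_relabel_symm` — the matrix of `(UForm.relabel eP eQ)⁻¹ g` is `g^{eP ⊕ eQ}`; hence
  **`coe_toUFormEquiv_symm_relabel_symm_expMem`**: along `g = exp (sY)` the local component is `exp (s Y₀)`,
  **`Y₀ = diag(D_σ)⁻¹ · Y^{ê} · diag(D_σ)`**, `ê = ε_σ ≫ (eP ⊕ eQ)` (★ `Matrix.exp_units_conj'`, ★ `exp_reindex`).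
* §2 **`exists_archSkew_expGL_eq_placeSecJ_expMem`** — for every `Y ∈ 𝔲(P′,Q′)` there is `X ∈ 𝔲 = archSkew F E c N J` with `X_{w(σ)} = Y₀`, `X_w = 0` for `w ≠ w(σ)`
  (★ `exists_archSkew_single`; the skewness of `Y₀` by ★ `skew_of_forall_exp_mem`) and **`exp (sX) = placeSecJ σ (exp (sY), 1)` in `U(J)(F ⊗ ℝ)` for all `s`**
  (place by place: ★ `archPiEquiv` is injective, ★ `coe_archAt_expGL_smul`, ★ `archAt_archSingle_self∕_of_ne`).
* §3 (doubled CM frame) **`exists_archSkew_archExp_eq_placeSecJ_expMem`** (`archExp hX s = archEmb (placeSecJ σ (exp (sY), 1))` in `H(𝔸)`) and THE CERTIFICATE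
  **`exists_archSkew_hasDerivAt_swSection_tmul_archExp`**: for `Y ∈ 𝔲(2,2)` there is `X ∈ archSkew` (supported at `σ`) with, for EVERY `h ∈ H(𝔸)`,
  `HasDerivAt (t ↦ swSection sD (a ⊗ f) (h · archExp hX t)) (swSection sD (a′ ⊗ f) h) 0`, `a′` the explicit vector of ★ `hasDerivAt_swSection_tmul_placeSecJ_expMem` — literally
  the shape of G1-END's `hXφ : ∀ h, HasDerivAt (fun t => φ (h * archExp … hX t)) (Xφ h) 0` for `φ = f_{a ⊗ f}`, `Xφ = f_{a′ ⊗ f}`.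

HONEST LABEL: HC_CM is proved only modulo the 7 printed citations (2 remaining named inputs: hLiu418 = stmt-HodgeConjecture-24832, h413 =
stmt-HodgeConjecture-24833) until rung 0 closes; organ capital for #42F′'s Road I, moves no counter.

## References
[BorelJacquet1979] A. Borel, H. Jacquet, Proc. Symp. Pure Math. 33.1 (1979), §4.1 · [Knapp2002] A. W. Knapp, *Lie Groups Beyond an Introduction* (2002), Introduction §2
Prop. 0.11, I §10 · [PlatonovRapinchuk1994] V. Platonov, A. Rapinchuk, *Algebraic Groups and Number Theory* (1994), §2.3 · [KudlaRallis1994] S. Kudla, S. Rallis,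
Ann. of Math. 140 (1994), §1 · [Folland1989] G. B. Folland, *Harmonic Analysis in Phase Space* (1989), §4.2 (4.24), Prop. (4.39).
-/

set_option autoImplicit false
set_option linter.dupNamespace false

noncomputable section

open scoped Classical Matrix TensorProduct SchwartzMap MatrixGroups Matrix.Norms.Operator
open NumberField NumberField.InfinitePlace NumberField.mixedEmbedding IsDedekindDomain NormedSpace
open Literature.Analysis.SegalBargmann Literature.Analysis.Distribution
open Literature.RepresentationTheory.HeisenbergGroup
open Literature.NumberTheory.Automorphic Literature.NumberTheory.Automorphic.UnitaryGroup
open Literature.NumberTheory.Weil1964 Literature.NumberTheory.Weil1964.MpS Literature.NumberTheory.Weil1964.UnitaryWeil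
open Literature.RepresentationTheory.HarrisKudlaSweet1996 Literature.NumberTheory.GaloisRepresentations
open Literature.NumberTheory.GelbartRogawski1991 Literature.NumberTheory.GelbartRogawski1991.UnitaryDualPair
open Literature.NumberTheory.GelbartRogawski1991.UnitaryDualPair.LocalSplitting
open Literature.NumberTheory.GelbartRogawski1991.GRConstruction
open Literature.NumberTheory.K2Lit.SiegelDoubled
open Literature.RepresentationTheory.KonnoKonno2007 hiding LetterKind letterOf letterGen letterOf_boost letterOf_torus letterOf_torus_eq
  letterGen_boost letterGen_torus letterGen_mem_lie exp_smul_letterGen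
open Literature.RepresentationTheory.KonnoKonno2007.RealDualPair
open Literature.Analysis.Matrix.KroneckerSum (exp_reindex)
open Summit.HodgeConjecture.HodgeConjecture.Cruxes.HLiu418.K2LiuU22AdaptedBasis
open Summit.HodgeConjecture.HodgeConjecture.Cruxes.HLiu418.K2LiuArchSkewPlaces
open Summit.HodgeConjecture.HodgeConjecture.Cruxes.HLiu418 (K2LiuArchOneParameterOrbitDefs.archEmb K2LiuArchOneParameterOrbitDefs.archExp
  K2LiuArchOneParameterOrbitDefs.archExp_eq_archEmb)

-- Mathlib idiom (`Mathlib/Algebra/Lie/OfAssociative.lean`), as in ★ `RealMatrixGroups` ∕ (G2-W2): the commutator bracket on `Matrix n n ℂ`, needed to name the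
-- Lie algebra `(uFormGroup P′ Q′).lie`
attribute [local instance 100] LieRing.ofAssociativeRing

/-! ## §1 The sign-frame chart in matrices -/

namespace Summit.HodgeConjecture.HodgeConjecture.Cruxes.HLiu418.K2LiuArchSectionPlaceBlock

section Chart

variable {F : Type} [Field F] [NumberField F] (E : Type) [Field E] [NumberField E] [Algebra F E] (c : E ≃ₐ[F] E)
  (N : ℕ) (hc : c ≠ 1)
  (wOf : {v : InfinitePlace F // v.IsReal} → {w : InfinitePlace E // w.IsComplex})
  (hw : ∀ v, c • (wOf v).1 = (wOf v).1) (t₀ : Fin N → F) (ht0 : ∀ j, t₀ j ≠ 0) {δ : E} (hcδ : c δ = -δ) (hδ : δ ≠ 0)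
  (σ : {v : InfinitePlace F // v.IsReal})
  (hover : ∀ v, (wOf v).1.comap (algebraMap F E) = v.1) {T : Matrix (Fin N) (Fin N) F} (hTd : T = Matrix.diagonal t₀)
  {J : Matrix (Fin N) (Fin N) E} (hJ : J = T.map (algebraMap F E)) (hfix : ∀ w : InfinitePlace E, c • w = w)
  {P' Q' : Type} [Fintype P'] [DecidableEq P'] [Fintype Q'] [DecidableEq Q']
  (eP : PosIdx (signVec wOf t₀ δ σ) ≃ P') (eQ : NegIdx (signVec wOf t₀ δ σ) ≃ Q')

/-- **the inverse sign-frame chart in matrices**: the matrix of `(toUFormEquiv ε_σ D_σ c_σ)⁻¹ g′ ∈ U(σ_{w(σ)} J)(ℂ)` is `diag(D_σ)⁻¹ · g′^{ε_σ} · diag(D_σ)`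
(`g′^{ε} = g′.submatrix ε ε`; ★ `coe_toUForm` read backwards through ★ `toUForm_toUFormEquiv_symm`). [cite: PlatonovRapinchuk1994, §2.3] -/
theorem coe_toUFormEquiv_symm (g' : UForm (PosIdx (signVec wOf t₀ δ σ)) (NegIdx (signVec wOf t₀ δ σ))) :
    ((((toUFormEquiv (signSplit (signVec wOf t₀ δ σ)) (sqrtAbs_signVec_ne_zero hc hw hcδ hδ ht0 σ) (deltaIm_ne_zero hc hw hcδ hδ σ)
        (formCongr_signFrame_eq E c N hc wOf hw t₀ ht0 hcδ hδ σ hover hTd hJ)).symm g' :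
        unitaryGroupOfForm (starRingEnd ℂ) (J.map (wOf σ).1.embedding)) : GL (Fin N) ℂ) : Matrix (Fin N) (Fin N) ℂ) =
      Matrix.diagonal (fun j => ((sqrtAbs (signVec wOf t₀ δ σ) j : ℂ))⁻¹) *
        ((g' : GL (PosIdx (signVec wOf t₀ δ σ) ⊕ NegIdx (signVec wOf t₀ δ σ)) ℂ) :
          Matrix _ _ ℂ).submatrix (signSplit (signVec wOf t₀ δ σ)) (signSplit (signVec wOf t₀ δ σ)) *
        Matrix.diagonal (fun j => (sqrtAbs (signVec wOf t₀ δ σ) j : ℂ)) := by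
  set k := (toUFormEquiv (signSplit (signVec wOf t₀ δ σ)) (sqrtAbs_signVec_ne_zero hc hw hcδ hδ ht0 σ) (deltaIm_ne_zero hc hw hcδ hδ σ)
    (formCongr_signFrame_eq E c N hc wOf hw t₀ ht0 hcδ hδ σ hover hTd hJ)).symm g' with hk
  have h1 := coe_toUForm (signSplit (signVec wOf t₀ δ σ)) (sqrtAbs_signVec_ne_zero hc hw hcδ hδ ht0 σ) (deltaIm_ne_zero hc hw hcδ hδ σ)
    (formCongr_signFrame_eq E c N hc wOf hw t₀ ht0 hcδ hδ σ hover hTd hJ) k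
  rw [toUForm_toUFormEquiv_symm] at h1
  -- `scaleConj D K = g′^{ε}`
  have h2 : scaleConj (sqrtAbs (signVec wOf t₀ δ σ)) ((k : GL (Fin N) ℂ) : Matrix (Fin N) (Fin N) ℂ) =
      ((g' : GL (PosIdx (signVec wOf t₀ δ σ) ⊕ NegIdx (signVec wOf t₀ δ σ)) ℂ) : Matrix _ _ ℂ).submatrix
        (signSplit (signVec wOf t₀ δ σ)) (signSplit (signVec wOf t₀ δ σ)) := by
    rw [h1, Matrix.reindex_apply, Matrix.submatrix_submatrix, Equiv.symm_comp_self, Matrix.submatrix_id_id]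
  rw [← scaleGL_mul_mul_inv _ (sqrtAbs_signVec_ne_zero hc hw hcδ hδ ht0 σ), coe_scaleGL, coe_scaleGL_inv] at h2
  -- cancel the diagonal conjugation
  have hcancel : Matrix.diagonal (fun j => ((sqrtAbs (signVec wOf t₀ δ σ) j : ℂ))⁻¹) *
      Matrix.diagonal (fun j => (sqrtAbs (signVec wOf t₀ δ σ) j : ℂ)) = 1 := by
    rw [Matrix.diagonal_mul_diagonal, ← Matrix.diagonal_one]
    exact congrArg Matrix.diagonal (funext fun j => inv_mul_cancel₀ (Complex.ofReal_ne_zero.2 (sqrtAbs_signVec_ne_zero hc hw hcδ hδ ht0 σ j)))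
  rw [← h2]
  simp only [← Matrix.mul_assoc]
  rw [hcancel, Matrix.one_mul, Matrix.mul_assoc, hcancel, Matrix.mul_one]

omit [NumberField F] [NumberField E] [Algebra F E] in
/-- the matrix of `(UForm.relabel eP eQ)⁻¹ g` is `g^{eP ⊕ eQ}` (★ `UForm.coe_relabel` read backwards). [folklore] -/
theorem coe_relabel_symm (g : UForm P' Q') :
    ((((UForm.relabel (PosIdx (signVec wOf t₀ δ σ)) (NegIdx (signVec wOf t₀ δ σ)) P' Q' eP eQ).symm g :
        UForm (PosIdx (signVec wOf t₀ δ σ)) (NegIdx (signVec wOf t₀ δ σ))) :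
        GL (PosIdx (signVec wOf t₀ δ σ) ⊕ NegIdx (signVec wOf t₀ δ σ)) ℂ) : Matrix _ _ ℂ) =
      ((g : GL (P' ⊕ Q') ℂ) : Matrix (P' ⊕ Q') (P' ⊕ Q') ℂ).submatrix (Equiv.sumCongr eP eQ) (Equiv.sumCongr eP eQ) := by
  have h := UForm.coe_relabel eP eQ ((UForm.relabel (PosIdx (signVec wOf t₀ δ σ)) (NegIdx (signVec wOf t₀ δ σ)) P' Q' eP eQ).symm g)
  rw [ContinuousMulEquiv.apply_symm_apply] at h
  rw [h, Matrix.reindex_apply, Matrix.submatrix_submatrix, Equiv.symm_comp_self, Matrix.submatrix_id_id]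

/-- **the local component along `g = exp (sY)`**: the matrix of `(toUFormEquiv ε_σ D_σ c_σ)⁻¹ ((relabel eP eQ)⁻¹ (exp (sY)))` is `exp (s · Y₀)`,
`Y₀ = diag(D_σ)⁻¹ · Y^{ê} · diag(D_σ)`, `ê = ε_σ ≫ (eP ⊕ eQ)` — conjugation and reindexing commute with the matrix exponential (★ `Matrix.exp_units_conj'`, ★ `exp_reindex`).
[cite: Knapp2002, Introduction §2 Prop. 0.11] [cite: PlatonovRapinchuk1994, §2.3] -/
theorem coe_toUFormEquiv_symm_relabel_symm_expMem (Y : ↥(uFormGroup P' Q').lie.toSubmodule) (s : ℝ) :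
    ((((toUFormEquiv (signSplit (signVec wOf t₀ δ σ)) (sqrtAbs_signVec_ne_zero hc hw hcδ hδ ht0 σ) (deltaIm_ne_zero hc hw hcδ hδ σ)
        (formCongr_signFrame_eq E c N hc wOf hw t₀ ht0 hcδ hδ σ hover hTd hJ)).symm
        ((UForm.relabel (PosIdx (signVec wOf t₀ δ σ)) (NegIdx (signVec wOf t₀ δ σ)) P' Q' eP eQ).symm
          (((uFormGroup P' Q').expMem
          ⟨((s • Y : ↥(uFormGroup P' Q').lie.toSubmodule) : Matrix (P' ⊕ Q') (P' ⊕ Q') ℂ), (s • Y).2⟩ : UForm P' Q'))) :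
        unitaryGroupOfForm (starRingEnd ℂ) (J.map (wOf σ).1.embedding)) : GL (Fin N) ℂ) : Matrix (Fin N) (Fin N) ℂ) =
      exp (s • (Matrix.diagonal (fun j => ((sqrtAbs (signVec wOf t₀ δ σ) j : ℂ))⁻¹) *
        (Y : Matrix (P' ⊕ Q') (P' ⊕ Q') ℂ).submatrix ((signSplit (signVec wOf t₀ δ σ)).trans (Equiv.sumCongr eP eQ))
          ((signSplit (signVec wOf t₀ δ σ)).trans (Equiv.sumCongr eP eQ)) *
        Matrix.diagonal (fun j => (sqrtAbs (signVec wOf t₀ δ σ) j : ℂ)))) := by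
  rw [coe_toUFormEquiv_symm E c N hc wOf hw t₀ ht0 hcδ hδ σ hover hTd hJ, coe_relabel_symm, RealMatrixGroup.coe_expMem, coe_expGL,
    Matrix.submatrix_submatrix, ← Equiv.coe_trans, Submodule.coe_smul]
  -- `exp` commutes with the reindexing `ê` …
  have hre := exp_reindex ((signSplit (signVec wOf t₀ δ σ)).trans (Equiv.sumCongr eP eQ)).symm (s • (Y : Matrix (P' ⊕ Q') (P' ⊕ Q') ℂ))
  rw [Matrix.reindex_apply, Matrix.reindex_apply, Equiv.symm_symm] at hre
  rw [← hre]
  -- … and with the diagonal conjugation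
  have hconj := Matrix.exp_units_conj' (scaleGL (sqrtAbs (signVec wOf t₀ δ σ)) (sqrtAbs_signVec_ne_zero hc hw hcδ hδ ht0 σ))
    ((s • (Y : Matrix (P' ⊕ Q') (P' ⊕ Q') ℂ)).submatrix ((signSplit (signVec wOf t₀ δ σ)).trans (Equiv.sumCongr eP eQ))
      ((signSplit (signVec wOf t₀ δ σ)).trans (Equiv.sumCongr eP eQ)))
  rw [coe_scaleGL, coe_scaleGL_inv] at hconj
  rw [← hconj]
  congr 1
  simp only [Matrix.submatrix_smul, Pi.smul_apply, Matrix.mul_smul, Matrix.smul_mul]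

/-! ## §2 The curve `s ↦ placeSecJ σ (exp (sY), 1)` is an archimedean one-parameter orbit -/

/-- **`placeSecJ σ (exp (sY), 1) = exp (sX)` FOR A LETTER `X ∈ 𝔲` SUPPORTED AT `σ`.**  For every `Y ∈ 𝔲(P′,Q′)` there is `X ∈ archSkew F E c N J` whose `w(σ)`-coordinate
is `Y₀ = diag(D_σ)⁻¹ · Y^{ê} · diag(D_σ)` and whose other coordinates vanish (★ `exists_archSkew_single`; `Y₀` is skew because `exp (tY₀) ∈ U(σ_{w(σ)} J)(ℂ)` for all `t`,
★ `skew_of_forall_exp_mem`), such that `⟨exp (sX), _⟩ = placeSecJ σ (exp (sY), 1)` in `U(J)(F ⊗ ℝ)` for all real `s` (place by place: ★ `archPiEquiv` is injective, ★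
`coe_archAt_expGL_smul`, ★ `archAt_archSingle_self` ∕ `_of_ne`, §1). [cite: BorelJacquet1979, §4.1] [cite: Knapp2002, Introduction §2 Prop. 0.11] -/
theorem exists_archSkew_expGL_eq_placeSecJ_expMem (Y : ↥(uFormGroup P' Q').lie.toSubmodule) :
    ∃ (X : Matrix (Fin N) (Fin N) (mixedSpace E)) (hX : X ∈ archSkew F E c N J),
      (∀ s : ℝ, (⟨expGL (s • X), expGL_smul_mem_arch J hX s⟩ : UnitaryGroup.arch F E c N J) =
        placeSecJ E c N hc wOf hw t₀ ht0 hcδ hδ σ hover hTd hJ hfix eP eQ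
          (((((uFormGroup P' Q').expMem
          ⟨((s • Y : ↥(uFormGroup P' Q').lie.toSubmodule) : Matrix (P' ⊕ Q') (P' ⊕ Q') ℂ), (s • Y).2⟩ : UForm P' Q')), (1 : UForm Unit Empty)) : Ginf P' Q' Unit Empty)) ∧
      X.map (evalC E (wOf σ)) = Matrix.diagonal (fun j => ((sqrtAbs (signVec wOf t₀ δ σ) j : ℂ))⁻¹) *
        (Y : Matrix (P' ⊕ Q') (P' ⊕ Q') ℂ).submatrix ((signSplit (signVec wOf t₀ δ σ)).trans (Equiv.sumCongr eP eQ))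
          ((signSplit (signVec wOf t₀ δ σ)).trans (Equiv.sumCongr eP eQ)) *
        Matrix.diagonal (fun j => (sqrtAbs (signVec wOf t₀ δ σ) j : ℂ)) ∧
      ∀ w : {w : InfinitePlace E // w.IsComplex}, w ≠ wOf σ → X.map (evalC E w) = 0 := by
  -- the one-parameter group `t ↦ exp (t Y₀)` lies in `U(σ_{w(σ)} J)(ℂ)`: it is the chart image of `exp (tY)`
  have hmem : ∀ t : ℝ, expGL (t • (Matrix.diagonal (fun j => ((sqrtAbs (signVec wOf t₀ δ σ) j : ℂ))⁻¹) *
      (Y : Matrix (P' ⊕ Q') (P' ⊕ Q') ℂ).submatrix ((signSplit (signVec wOf t₀ δ σ)).trans (Equiv.sumCongr eP eQ))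
        ((signSplit (signVec wOf t₀ δ σ)).trans (Equiv.sumCongr eP eQ)) *
      Matrix.diagonal (fun j => (sqrtAbs (signVec wOf t₀ δ σ) j : ℂ)))) ∈ archLocal E N J (wOf σ) := by
    intro t
    have heq : expGL (t • (Matrix.diagonal (fun j => ((sqrtAbs (signVec wOf t₀ δ σ) j : ℂ))⁻¹) *
        (Y : Matrix (P' ⊕ Q') (P' ⊕ Q') ℂ).submatrix ((signSplit (signVec wOf t₀ δ σ)).trans (Equiv.sumCongr eP eQ))
          ((signSplit (signVec wOf t₀ δ σ)).trans (Equiv.sumCongr eP eQ)) *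
        Matrix.diagonal (fun j => (sqrtAbs (signVec wOf t₀ δ σ) j : ℂ)))) =
      (((toUFormEquiv (signSplit (signVec wOf t₀ δ σ)) (sqrtAbs_signVec_ne_zero hc hw hcδ hδ ht0 σ) (deltaIm_ne_zero hc hw hcδ hδ σ)
        (formCongr_signFrame_eq E c N hc wOf hw t₀ ht0 hcδ hδ σ hover hTd hJ)).symm
        ((UForm.relabel (PosIdx (signVec wOf t₀ δ σ)) (NegIdx (signVec wOf t₀ δ σ)) P' Q' eP eQ).symm
          (((uFormGroup P' Q').expMem
          ⟨((t • Y : ↥(uFormGroup P' Q').lie.toSubmodule) : Matrix (P' ⊕ Q') (P' ⊕ Q') ℂ), (t • Y).2⟩ : UForm P' Q'))) :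
        unitaryGroupOfForm (starRingEnd ℂ) (J.map (wOf σ).1.embedding)) : GL (Fin N) ℂ) :=
      Units.ext (by rw [coe_expGL, coe_toUFormEquiv_symm_relabel_symm_expMem E c N hc wOf hw t₀ ht0 hcδ hδ σ hover hTd hJ eP eQ Y t])
    rw [heq]
    exact SetLike.coe_mem _
  obtain ⟨X, hX, hXσ, hXw⟩ := exists_archSkew_single F E c N J hc hfix (wOf σ) _ (skew_of_forall_exp_mem E N J (wOf σ) _ hmem)
  refine ⟨X, hX, fun s => ?_, hXσ, hXw⟩
  apply (archPiEquiv F E c N J hc hfix).injective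
  funext w
  rw [archPiEquiv_apply, archPiEquiv_apply, placeSecJ_inl, placeSec_apply]
  by_cases hw' : w = wOf σ
  · subst hw'
    rw [archAt_archSingle_self]
    refine Subtype.ext (Units.ext ?_)
    rw [coe_archAt_expGL_smul F E c N J hc (wOf σ) (hfix _) hX s, hXσ,
      coe_toUFormEquiv_symm_relabel_symm_expMem E c N hc wOf hw t₀ ht0 hcδ hδ σ hover hTd hJ eP eQ Y s]
  · rw [archAt_archSingle_of_ne F E c N J hc hfix (wOf σ) hw']
    refine Subtype.ext (Units.ext ?_)
    rw [coe_archAt_expGL_smul F E c N J hc w (hfix _) hX s, hXw w hw', smul_zero, NormedSpace.exp_zero]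
    rfl

end Chart

end Summit.HodgeConjecture.HodgeConjecture.Cruxes.HLiu418.K2LiuArchSectionPlaceBlock

/-! ## §3 The doubled CM frame: `archExp hX s = archEmb (placeSecJ σ (exp (sY), 1))` and the `hXφ` certificate -/

namespace Summit.HodgeConjecture.HodgeConjecture.Cruxes.HLiu418.K2LiuSwSectionArchOrbit

open Summit.HodgeConjecture.HodgeConjecture.Cruxes.HLiu418.K2LiuArchSectionPlaceBlock

-- the doubled metaplectic carrier `Mp(𝕎^𝔻)ᶜᵒⁿᵗ` and the CM sign frame elaborate slowly (cf. ★ `K2LiuSwSectionArchOrbitSmooth`)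
set_option maxHeartbeats 2000000

variable (L : Type) [Field L] [NumberField L] [IsCMField L]

variable {N M n : ℕ} (e : Fin N × Fin M ≃ Fin n)
  (dV : Fin N → L) (hdV : ∀ i, IsCMField.complexConj L (dV i) = dV i) (hdV0 : ∀ i, dV i ≠ 0)
  (dW : Fin M → L) (hdW : ∀ i, IsCMField.complexConj L (dW i) = dW i) (hdW0 : ∀ i, dW i ≠ 0)
  (σ : {v : InfinitePlace (Fp L) // v.IsReal})
  (e₂P : PosIdx (signVec (cmPlaceOver L)
      (fun k => Sum.elim (cmGramEntry L e dV hdV dW hdW) (-cmGramEntry L e dV hdV dW hdW) ((LocalSplitting.e₂ n).symm k)) (imagUnit L) σ) ≃ Fin 2)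
  (e₂Q : NegIdx (signVec (cmPlaceOver L)
      (fun k => Sum.elim (cmGramEntry L e dV hdV dW hdW) (-cmGramEntry L e dV hdV dW hdW) ((LocalSplitting.e₂ n).symm k)) (imagUnit L) σ) ≃ Fin 2)

include hdV0 hdW0 in
/-- **`archExp hX s = archEmb (placeSecJ σ (exp (sY), 1))` IN `H(𝔸)`**: for every `Y ∈ 𝔲(2,2)` there is `X ∈ archSkew` of the doubled group `H = U(hermD)`, supported at the
real place `σ`, whose one-parameter orbit ★ `archExp hX` (the letter of G1-END ∕ #41's families) IS the one-place curve of (W4-ii) (§2 + ★ `archExp_eq_archEmb`).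
[cite: BorelJacquet1979, §4.1] [cite: Knapp2002, Introduction §2 Prop. 0.11] -/
theorem exists_archSkew_archExp_eq_placeSecJ_expMem (Y : ↥(uFormGroup (Fin 2) (Fin 2)).lie.toSubmodule) :
    ∃ (X : Matrix (Fin (n + n)) (Fin (n + n)) (mixedSpace L)) (hX : X ∈ archSkew (Fp L) L (IsCMField.complexConj L) (n + n) (hermD L e dV hdV dW hdW)),
      (∀ s : ℝ, K2LiuArchOneParameterOrbitDefs.archExp (Fp L) L (IsCMField.complexConj L) (n + n) (hermD L e dV hdV dW hdW) hX s =
        K2LiuArchOneParameterOrbitDefs.archEmb (Fp L) L (IsCMField.complexConj L) (n + n) (hermD L e dV hdV dW hdW)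
          (placeSecJ L (IsCMField.complexConj L) (n + n) (IsCMField.complexConj_ne_one L) (cmPlaceOver L) (cmPlaceOver_smul L) _
            (gramD_gram_realDiagonal_entry_ne_zero L e dV hdV dW hdW hdV0 hdW0) (complexConj_imagUnit L) (imagUnit_ne_zero L) σ
            (cmPlaceOver_comap L) (gramD_eq_diagonal_cm L e dV hdV dW hdW) (J := hermD L e dV hdV dW hdW) rfl
            (complexConj_smul_infinitePlace L) e₂P e₂Q
            ((((uFormGroup (Fin 2) (Fin 2)).expMem
                ⟨((s • Y : ↥(uFormGroup (Fin 2) (Fin 2)).lie.toSubmodule) : Matrix (Fin 2 ⊕ Fin 2) (Fin 2 ⊕ Fin 2) ℂ), (s • Y).2⟩ :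
                UForm (Fin 2) (Fin 2)), (1 : UForm Unit Empty)) : Ginf (Fin 2) (Fin 2) Unit Empty))) ∧
      ∀ w : {w : InfinitePlace L // w.IsComplex}, w ≠ cmPlaceOver L σ → X.map (evalC L w) = 0 := by
  obtain ⟨X, hX, hcurve, -, hXw⟩ := exists_archSkew_expGL_eq_placeSecJ_expMem L (IsCMField.complexConj L) (n + n) (IsCMField.complexConj_ne_one L)
    (cmPlaceOver L) (cmPlaceOver_smul L) _ (gramD_gram_realDiagonal_entry_ne_zero L e dV hdV dW hdW hdV0 hdW0) (complexConj_imagUnit L) (imagUnit_ne_zero L) σ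
    (cmPlaceOver_comap L) (gramD_eq_diagonal_cm L e dV hdV dW hdW) (J := hermD L e dV hdV dW hdW) rfl (complexConj_smul_infinitePlace L) e₂P e₂Q Y
  refine ⟨X, hX, fun s => ?_, hXw⟩
  rw [K2LiuArchOneParameterOrbitDefs.archExp_eq_archEmb, hcurve s]

include hdV0 hdW0 in
/-- **THE `hXφ` CERTIFICATE FOR SIEGEL–WEIL SECTIONS (G1-END's letter, by name).**  Let `sD` be ANY `χ`-normalised doubled Weil representation (`χ` unitary, `χ|_{𝕀_{L⁺}} = ε`,
odd unitary archimedean type `(t, 0)`), `f ∈ 𝒮(X_f)`, `σ` a real place with sign types `≃ Fin 2`, `Y ∈ 𝔲(2,2)` and `a ∈ 𝓢(X_∞)` with `𝒥 a = Φ₁ ⊠ Φ₂`.  Then there is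
`X ∈ archSkew` of `H`, supported at `σ`, such that FOR EVERY `h ∈ H(𝔸)`
`HasDerivAt (t ↦ swSection sD (a ⊗ f) (h · archExp hX t)) (swSection sD (a′ ⊗ f) h) 0` with the EXPLICIT `a′ = η′_Y • a + 𝒥⁻¹((dω_Y Φ₁) ⊠ Φ₂)` of ★
`hasDerivAt_swSection_tmul_placeSecJ_expMem` — the hypothesis `hXφ : ∀ h, HasDerivAt (fun t => φ (h * archExp … hX t)) (Xφ h) 0` of ★
`K2LiuFlatSectionLieDerivative.hasDerivAt_stdExtension_orbit` ∕ G1-END for `φ = f_{a ⊗ f}`, `Xφ = f_{a′ ⊗ f}`. [cite: KudlaRallis1994, §1] [cite: Folland1989, §4.2 (4.24), Prop. (4.39)]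
[cite: BorelJacquet1979, §4.1] -/
theorem exists_archSkew_hasDerivAt_swSection_tmul_archExp {χ : HeckeCharacter L} (hχu : χ.IsUnitary) (hχs : IsSplittingChar L 1 χ)
    {sD : HA L e dV hdV dW hdW →* MpD L e dV hdV dW hdW} (hsD : IsDoubledWeilRep L e dV hdV hdV0 dW hdW hdW0 χ sD)
    {t : InfinitePlace L → ℤ} (ht : χ.HasUnitaryArchType t 0) (hodd : ∀ w, Odd (t w))
    (f : FinSB (Fp L) (Fin (n + n))) (Y : ↥(uFormGroup (Fin 2) (Fin 2)).lie.toSubmodule)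
    (Φ₁ : 𝓢((DPIdx (Fin 2) (Fin 2) Unit Empty → ℝ), ℂ)) (Φ₂ : 𝓢(((Fin (n + n) × {v : {v : InfinitePlace (Fp L) // v.IsReal} // v ≠ σ}) → ℝ), ℂ))
    {a : 𝓢((Fin (n + n) → mixedSpace (Fp L)), ℂ)}
    (ha : ((((schwartzTransport
                  (scaledFrame (Fp L) (Fin (n + n))
                    (placeScale (n + n) fun v => sqrtAbs (signVec (cmPlaceOver L)
                      (fun k => Sum.elim (cmGramEntry L e dV hdV dW hdW) (-cmGramEntry L e dV hdV dW hdW) ((LocalSplitting.e₂ n).symm k))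
                      (imagUnit L) v))
                    (placeScale_ne_zero (n + n) (sqrtAbs_signVec_ne_zero (IsCMField.complexConj_ne_one L) (cmPlaceOver_smul L)
                      (complexConj_imagUnit L) (imagUnit_ne_zero L) (gramD_gram_realDiagonal_entry_ne_zero L e dV hdV dW hdW hdV0 hdW0))))).trans
                (schwartzTransport (reindexCLE (placeSplitEquiv (signSplit (signVec (cmPlaceOver L)
                      (fun k => Sum.elim (cmGramEntry L e dV hdV dW hdW) (-cmGramEntry L e dV hdV dW hdW) ((LocalSplitting.e₂ n).symm k))
                      (imagUnit L) σ)) σ)))).trans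
                (schwartzTransport (reindexCLE (Equiv.sumCongr
                  (unitJunctionIdx (PosIdx (signVec (cmPlaceOver L)
                      (fun k => Sum.elim (cmGramEntry L e dV hdV dW hdW) (-cmGramEntry L e dV hdV dW hdW) ((LocalSplitting.e₂ n).symm k))
                      (imagUnit L) σ)) (NegIdx (signVec (cmPlaceOver L)
                      (fun k => Sum.elim (cmGramEntry L e dV hdV dW hdW) (-cmGramEntry L e dV hdV dW hdW) ((LocalSplitting.e₂ n).symm k))
                      (imagUnit L) σ))).symm
                  (Equiv.refl (Fin (n + n) × {v : {v : InfinitePlace (Fp L) // v.IsReal} // v ≠ σ})))))).trans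
                (schwartzTransport (reindexCLE (Equiv.sumCongr
                  (dpIdxCongr (PosIdx (signVec (cmPlaceOver L)
                      (fun k => Sum.elim (cmGramEntry L e dV hdV dW hdW) (-cmGramEntry L e dV hdV dW hdW) ((LocalSplitting.e₂ n).symm k))
                      (imagUnit L) σ)) (NegIdx (signVec (cmPlaceOver L)
                      (fun k => Sum.elim (cmGramEntry L e dV hdV dW hdW) (-cmGramEntry L e dV hdV dW hdW) ((LocalSplitting.e₂ n).symm k))
                      (imagUnit L) σ))
                    Unit Empty (Fin 2) (Fin 2) Unit Empty e₂P e₂Q (Equiv.refl Unit) (Equiv.refl Empty)).symm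
                  (Equiv.refl (Fin (n + n) × {v : {v : InfinitePlace (Fp L) // v.IsReal} // v ≠ σ})))))) a = tensorPi Φ₁ Φ₂) :
    ∃ (X : Matrix (Fin (n + n)) (Fin (n + n)) (mixedSpace L)) (hX : X ∈ archSkew (Fp L) L (IsCMField.complexConj L) (n + n) (hermD L e dV hdV dW hdW)),
      (∀ w : {w : InfinitePlace L // w.IsComplex}, w ≠ cmPlaceOver L σ → X.map (evalC L w) = 0) ∧
      ∀ h : HA L e dV hdV dW hdW, HasDerivAt
        (fun s : ℝ => swSection L e dV hdV hdV0 dW hdW hdW0 sD (piSchwartzBruhatEquiv (Fp L) (Fin (n + n)) (a ⊗ₜ f))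
          (h * K2LiuArchOneParameterOrbitDefs.archExp (Fp L) L (IsCMField.complexConj L) (n + n) (hermD L e dV hdV dW hdW) hX s))
        (swSection L e dV hdV hdV0 dW hdW hdW0 sD (piSchwartzBruhatEquiv (Fp L) (Fin (n + n))
          ((deriv (fun s : ℝ => ((etaD L e dV hdV dW hdW t
              (placeSecJ L (IsCMField.complexConj L) (n + n) (IsCMField.complexConj_ne_one L) (cmPlaceOver L) (cmPlaceOver_smul L) _
            (gramD_gram_realDiagonal_entry_ne_zero L e dV hdV dW hdW hdV0 hdW0) (complexConj_imagUnit L) (imagUnit_ne_zero L) σ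
            (cmPlaceOver_comap L) (gramD_eq_diagonal_cm L e dV hdV dW hdW) (J := hermD L e dV hdV dW hdW) rfl
            (complexConj_smul_infinitePlace L) e₂P e₂Q
              ((((uFormGroup (Fin 2) (Fin 2)).expMem
                ⟨((s • Y : ↥(uFormGroup (Fin 2) (Fin 2)).lie.toSubmodule) : Matrix (Fin 2 ⊕ Fin 2) (Fin 2 ⊕ Fin 2) ℂ), (s • Y).2⟩ :
                UForm (Fin 2) (Fin 2)), (1 : UForm Unit Empty)) : Ginf (Fin 2) (Fin 2) Unit Empty)) : ℂˣ) : ℂ)) 0 • a +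
            ((((schwartzTransport
                  (scaledFrame (Fp L) (Fin (n + n))
                    (placeScale (n + n) fun v => sqrtAbs (signVec (cmPlaceOver L)
                      (fun k => Sum.elim (cmGramEntry L e dV hdV dW hdW) (-cmGramEntry L e dV hdV dW hdW) ((LocalSplitting.e₂ n).symm k))
                      (imagUnit L) v))
                    (placeScale_ne_zero (n + n) (sqrtAbs_signVec_ne_zero (IsCMField.complexConj_ne_one L) (cmPlaceOver_smul L)
                      (complexConj_imagUnit L) (imagUnit_ne_zero L) (gramD_gram_realDiagonal_entry_ne_zero L e dV hdV dW hdW hdV0 hdW0))))).trans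
                (schwartzTransport (reindexCLE (placeSplitEquiv (signSplit (signVec (cmPlaceOver L)
                      (fun k => Sum.elim (cmGramEntry L e dV hdV dW hdW) (-cmGramEntry L e dV hdV dW hdW) ((LocalSplitting.e₂ n).symm k))
                      (imagUnit L) σ)) σ)))).trans
                (schwartzTransport (reindexCLE (Equiv.sumCongr
                  (unitJunctionIdx (PosIdx (signVec (cmPlaceOver L)
                      (fun k => Sum.elim (cmGramEntry L e dV hdV dW hdW) (-cmGramEntry L e dV hdV dW hdW) ((LocalSplitting.e₂ n).symm k))
                      (imagUnit L) σ)) (NegIdx (signVec (cmPlaceOver L)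
                      (fun k => Sum.elim (cmGramEntry L e dV hdV dW hdW) (-cmGramEntry L e dV hdV dW hdW) ((LocalSplitting.e₂ n).symm k))
                      (imagUnit L) σ))).symm
                  (Equiv.refl (Fin (n + n) × {v : {v : InfinitePlace (Fp L) // v.IsReal} // v ≠ σ})))))).trans
                (schwartzTransport (reindexCLE (Equiv.sumCongr
                  (dpIdxCongr (PosIdx (signVec (cmPlaceOver L)
                      (fun k => Sum.elim (cmGramEntry L e dV hdV dW hdW) (-cmGramEntry L e dV hdV dW hdW) ((LocalSplitting.e₂ n).symm k))
                      (imagUnit L) σ)) (NegIdx (signVec (cmPlaceOver L)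
                      (fun k => Sum.elim (cmGramEntry L e dV hdV dW hdW) (-cmGramEntry L e dV hdV dW hdW) ((LocalSplitting.e₂ n).symm k))
                      (imagUnit L) σ))
                    Unit Empty (Fin 2) (Fin 2) Unit Empty e₂P e₂Q (Equiv.refl Unit) (Equiv.refl Empty)).symm
                  (Equiv.refl (Fin (n + n) × {v : {v : InfinitePlace (Fp L) // v.IsReal} // v ≠ σ})))))).symm
              (tensorPi (∑ i, (((u22AdaptedBasis.repr Y) i : ℝ) : ℂ) •
              (K2LiuWeilDatumSmoothU22.u22LetterOp Unit Empty (⟨-(Fintype.card Empty : ℤ), -(Fintype.card Unit : ℤ), -(Fintype.card (Fin 2) : ℤ), -(Fintype.card (Fin 2) : ℤ)⟩ : VacExponents) (u22FrameK i) (u22Kind i)).pre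
                ((K2LiuWeilDatumSmoothU22.u22LetterOp Unit Empty (⟨-(Fintype.card Empty : ℤ), -(Fintype.card Unit : ℤ), -(Fintype.card (Fin 2) : ℤ), -(Fintype.card (Fin 2) : ℤ)⟩ : VacExponents) (u22FrameK i) (u22Kind i)).gen
                  ((K2LiuWeilDatumSmoothU22.u22LetterOp Unit Empty (⟨-(Fintype.card Empty : ℤ), -(Fintype.card Unit : ℤ), -(Fintype.card (Fin 2) : ℤ), -(Fintype.card (Fin 2) : ℤ)⟩ : VacExponents) (u22FrameK i) (u22Kind i)).post Φ₁))) Φ₂)) ⊗ₜ f)) h) 0 := by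
  obtain ⟨X, hX, hcurve, hXw⟩ := exists_archSkew_archExp_eq_placeSecJ_expMem L e dV hdV hdV0 dW hdW hdW0 σ e₂P e₂Q Y
  refine ⟨X, hX, hXw, fun h => ?_⟩
  simp only [hcurve]
  exact hasDerivAt_swSection_tmul_placeSecJ_expMem L e dV hdV hdV0 dW hdW hdW0 σ e₂P e₂Q hχu hχs hsD ht hodd h f Y Φ₁ Φ₂ ha

end Summit.HodgeConjecture.HodgeConjecture.Cruxes.HLiu418.K2LiuSwSectionArchOrbit

end
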